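import Literature.AlgebraicGeometry.Resolution.RegularCentreRsopPart
import Literature.AlgebraicGeometry.Resolution.PrimeDivisorIdeals
import Literature.AlgebraicGeometry.Resolution.OrderGenericAlongPrime
import Mathlib.RingTheory.KrullDimension.Zero
import HarnessLib

/-!
# A curve of `V(J)` through a point of a threefold is cut out by two regular parameters (CoP1, §4)

Topic: `Literature/AlgebraicGeometry/Resolution`. [CoP1] = Cossart–Piltant, J. Algebra 320
(2008) 1051–1082, proof of Prop. 4.2, p. 8: "let `Y = V(y_1, …, y_r)` be permissible for `E` at
`x` (so `r = 2` or `r = 3`)" — on a regular threefold, a regular curve `Y ⊆ V(J)`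
(`dim V(J) ≤ 1`) through a closed point `x` is cut out at `x` by two members of a regular system
of parameters, the closed point itself by three. PROVED in the form needed to feed the
curve-centre statements (`NearPointsCurveCentre.lean`, `TauMaxCentre.lean`,
`CurveCentreSigmaCoincide.lean`, `NearPointsRational.lean`) from the hypotheses available on a
stage of [CoP1]'s algorithm (`dim ≤ 3`, `V(J)` of codimension `≥ 2`):

* `coheight_eq_two_of_specializes` — for `η ⤳ x`, `η ≠ x`, `1 < codim η`, `codim x ≤ 3`:
  `codim η = 2` and `codim x = 3`;
* `exists_isRsopPart_fin_two_of_specializes` — **for a regular closed `Y = cl{η}` through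
  `x ≠ η` with `1 < codim η` and `codim x ≤ 3` (and `𝒪_{X,x}` regular): `𝓘_{Y,x} = (c_1, c_2)`
  with `c` part of a regular system of parameters of `𝒪_{X,x}`** (`𝓘_{Y,x} = 𝔭_η` has height
  `codim η = 2`, `𝒪_{X,x}/𝔭_η` is regular of dimension `1`, Matsumura 14.2).

## Sources

* V. Cossart, O. Piltant, J. Algebra 320 (2008) 1051–1082, proof of Prop. 4.2, p. 8.
  [CossartPiltant2008]
* H. Matsumura, Commutative Ring Theory (1986), Thm. 14.2. [Matsumura1987]
-/

noncomputable section

open CategoryTheory AlgebraicGeometry TopologicalSpace IsLocalRing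

namespace Literature.AlgebraicGeometry.Resolution

universe u

open Scheme.IdealSheafData

variable {X : Scheme.{u}}

/-- For a proper generization `η` of `x` with `1 < codim η` and `codim x ≤ 3`:
`codim η = 2` and `codim x = 3`. [folklore] -/
theorem coheight_eq_two_of_specializes {η x : X} (hηx : η ⤳ x) (hxη : ¬ x ⤳ η)
    (hη : 1 < Order.coheight η) (hx3 : Order.coheight x ≤ 3) :
    Order.coheight η = 2 ∧ Order.coheight x = 3 := by
  have hlt : x < η := ⟨hηx, hxη⟩
  have h1 : Order.coheight η + 1 ≤ Order.coheight x := Order.coheight_add_one_le hlt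
  have hηtop : Order.coheight η ≠ ⊤ := by
    intro h
    rw [h, top_add] at h1
    exact ENat.coe_ne_top 3 (top_le_iff.mp (h1.trans hx3))
  obtain ⟨n, hn⟩ := ENat.ne_top_iff_exists.mp hηtop
  have h2 : 1 < n := by
    rw [← hn] at hη
    exact_mod_cast hη
  have h3 : n + 1 ≤ 3 := by
    have := h1.trans hx3
    rw [← hn] at this
    exact_mod_cast this
  obtain rfl : n = 2 := by omega
  have hcη : Order.coheight η = 2 := by
    rw [← hn]
    rfl
  refine ⟨hcη, le_antisymm hx3 ?_⟩
  rw [hcη] at h1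
  exact h1

/-- **A regular curve of `V(J)` through a point of a threefold is cut out by two regular
parameters.** Let `X` be locally Noetherian, `Y = cl{η}` a closed subset whose reduced
subscheme is regular, `x ∈ Y` with `x ≠ η` (`η ⤳ x`, `¬ x ⤳ η`), `1 < codim η`, `codim x ≤ 3`,
and `𝒪_{X,x}` regular. Then `𝓘_{Y,x}` is generated by two members of a regular system of
parameters of `𝒪_{X,x}`. [cite: CossartPiltant2008, proof of Prop. 4.2] -/
theorem exists_isRsopPart_fin_two_of_specializes [IsLocallyNoetherian X] {Y : Closeds X}
    (hreg : Scheme.IsRegular (vanishingIdeal Y).subscheme) {η x : X}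
    (hY : (Y : Set X) = closure {η}) (hηx : η ⤳ x) (hxη : ¬ x ⤳ η)
    (hη : 1 < Order.coheight η) (hx3 : Order.coheight x ≤ 3)
    [IsRegularLocalRing (X.presheaf.stalk x)] :
    ∃ c : Fin 2 → X.presheaf.stalk x, IsRsopPart c ∧
      Ideal.span (Set.range c) = stalkIdeal (vanishingIdeal Y) x := by
  obtain ⟨hcη, hcx⟩ := coheight_eq_two_of_specializes hηx hxη hη hx3
  -- `Y = cl{η}`, `x ∈ Y`, `𝓘_{Y,x} = 𝔭_η` of height `2`, `dim 𝒪_{X,x} = 3`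
  have hYc : Y = ⟨closure {η}, isClosed_closure⟩ := Closeds.ext hY
  have hxY : x ∈ (Y : Set X) := by
    rw [hY]
    exact specializes_iff_mem_closure.mp hηx
  have hP : stalkIdeal (vanishingIdeal Y) x = primeOfSpecializes hηx := by
    rw [hYc]
    exact stalkIdeal_vanishingIdeal_closure hηx
  have hPh : (primeOfSpecializes hηx).height = 2 := by
    have h := coe_height_primeOfSpecializes hηx
    rw [hcη] at h
    exact_mod_cast h
  have hdimx : ringKrullDim (X.presheaf.stalk x) = 3 := by
    rw [ringKrullDim_stalk_eq_coheight, hcx]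
    rfl
  -- `𝓘_{Y,x} = (c_1, …, c_r)`, `c` part of a regular system of parameters, `dim 𝒪/𝔭_η + r = 3`
  obtain ⟨r, c, hcr, hcY⟩ := exists_isRsopPart_span_range_eq_stalkIdeal_of_mem_closeds hreg hxY
  have hq := hcr.ringKrullDim_quotient_add
  rw [hcY, hP, hdimx] at hq
  -- `dim 𝒪/𝔭_η + 2 ≤ 3` and `dim 𝒪/𝔭_η ≠ 0` (`𝔭_η` is not maximal: its height is `2 < 3`)
  have hup := ringKrullDim_quotient_add_natCast_le_of_height_eq (primeOfSpecializes hηx) hPh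
  rw [hdimx] at hup
  have hxC : x ∈ (vanishingIdeal Y).support := by
    rw [← SetLike.mem_coe, coe_support_vanishingIdeal]
    exact hxY
  haveI hRq : IsRegularLocalRing (X.presheaf.stalk x ⧸ primeOfSpecializes hηx) :=
    hP ▸ isRegularLocalRing_stalk_quotient_stalkIdeal hreg hxC
  obtain ⟨k, hk⟩ := exists_nat_cast_eq_ringKrullDim (R := X.presheaf.stalk x ⧸ primeOfSpecializes hηx)
  have hk0 : k ≠ 0 := by
    rintro rfl
    haveI : Ring.KrullDimLE 0 (X.presheaf.stalk x ⧸ primeOfSpecializes hηx) :=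
      (ringKrullDimZero_iff_ringKrullDim_eq_zero).mpr (by exact_mod_cast hk)
    have hf := Ring.KrullDimLE.isField_of_isDomain (R := X.presheaf.stalk x ⧸ primeOfSpecializes hηx)
    have hmax := Ideal.Quotient.maximal_of_isField _ hf
    have heq := IsLocalRing.eq_maximalIdeal hmax
    have h3 := IsLocalRing.maximalIdeal_height_eq_ringKrullDim (R := X.presheaf.stalk x)
    rw [← heq, hPh, hdimx] at h3
    exact absurd h3 (by decide)
  rw [hk] at hq hup
  have h1 : ((k + r : ℕ) : WithBot ℕ∞) = 3 := by push_cast; exact hq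
  have h2 : ((k + 2 : ℕ) : WithBot ℕ∞) ≤ 3 := by push_cast; exact hup
  have h1' : k + r = 3 := by exact_mod_cast h1
  have h2' : k + 2 ≤ 3 := by exact_mod_cast h2
  obtain rfl : r = 2 := by omega
  exact ⟨c, hcr, hcY⟩

end Literature.AlgebraicGeometry.Resolution

end
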